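import Literature.Probability.RandomGraphs.LowDegree
import HarnessLib

/-!
# Fourier–Walsh expansion of real functions on the cube `{0,1}^m`

Infrastructure (O'Donnell, *Analysis of Boolean Functions*, 2014, Ch. 1 and §3.3) for the
Fourier-analytic arguments about Boolean circuits in `Literature/Computability` (Fourier tails of
bounded-depth circuits, Linial–Mansour–Nisan 1993, Tal 2017; the Raz–Tal analysis of the Forrelation
distribution, file `Literature/Computability/QuantumComplexity/RazTalBoundedDepth`). The characters
`walsh S x = ∏_{i∈S} (-1)^{xᵢ}` and the sign `sgn` are those of
`Literature.Probability.RandomGraphs.LowDegree` (reused, not redefined).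

* `cubeFourierCoeff g S = ĝ(S) = 𝔼_x[g(x) χ_S(x)]` for `g : {0,1}^m → ℝ`;
* orthogonality summed over points (`sum_walsh_mul_walsh_index`), Fourier inversion
  (`sum_cubeFourierCoeff_mul_walsh`, O'Donnell Thm 1.1), Parseval (`sum_cubeFourierCoeff_sq`,
  O'Donnell §1.4), `ĝ(∅) = 𝔼 g`;
* restrictions: the coordinates in `J` fixed to `σ` is Mathlib's `J.piecewise σ x`
  (`Finset.piecewise`, not redefined), and the coefficients of the restricted function
  `x ↦ g (J.piecewise σ x)` (`cubeFourierCoeff_piecewise`, O'Donnell Prop. 3.21).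

Everything is a finite sum and is proved. Mathlib has no Boolean Fourier analysis (searched
`Walsh`, `Fourier` on `Bool`-cubes; `Mathlib.Analysis.Fourier` is about `AddCircle`/groups and
would force the `ZMod 2`-module view with far more plumbing than these finite identities).

Relation to the tree: `Literature.QuantumAdvantage.boolFourierCoeff f S` of
`Literature/Computability/QuantumComplexity/RazTalForrelation` (the coefficient of a *Boolean*
`f` read in `{±1}`, used by the named facts `Tal2017_fourierL1_ac0`, `RazTal2022_thm74`) is the
`sgn`-specialisation `cubeFourierCoeff (fun x => sgn (f x)) S` — by `rfl`; real-valued `g` is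
needed here (Parseval, restrictions, the Linial–Mansour–Nisan/Tal arguments). The bridge lemma
`boolFourierCoeff_eq_cubeFourierCoeff` (and `sum_walsh_eq_zero` of that file as the case `T = ∅`
of `sum_walsh_mul_walsh_index`) is filed in the first module importing both,
`Literature/Computability/QuantumComplexity/RazTalBoundedDepth`; a librarian refactor may instead
turn `boolFourierCoeff` into this specialisation. Index type: statements are over `Fin m`
(not a general `Fintype ι`) because every consumer (`boolFourierCoeff`, the Tal/Raz–Tal facts,
circuits `Circuit (Fin m)`) is over `Fin m` and the normalisation `2 ^ m` is then literal.

## References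

* R. O'Donnell, *Analysis of Boolean Functions*, Cambridge University Press, 2014, §1.2–1.4
  (expansion, orthogonality, inversion, Parseval), §3.3 Prop. 3.21 (restrictions) [ODonnell2014].
-/

noncomputable section

namespace Literature.Computability.Complexity.LowDegree

open Finset

variable {m : ℕ}

/-! ### Coefficients, orthogonality, inversion, Parseval -/

/-- The Fourier–Walsh coefficient `ĝ(S) = 𝔼_x[g(x) χ_S(x)] = 2^{-m} ∑_x g(x) χ_S(x)` of a real
function on the cube `{0,1}^m` (O'Donnell 2014, §1.2). The coefficient
`Literature.QuantumAdvantage.boolFourierCoeff f S` of a Boolean `f` (file `RazTalForrelation`) is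
`cubeFourierCoeff (fun x => sgn (f x)) S` by `rfl` (bridge `boolFourierCoeff_eq_cubeFourierCoeff`
in file `RazTalBoundedDepth`). [cite: ODonnell2014, §1.2] -/
def cubeFourierCoeff (g : (Fin m → Bool) → ℝ) (S : Finset (Fin m)) : ℝ :=
  (∑ x, g x * Literature.Probability.RandomGraphs.LowDegree.walsh S x) / 2 ^ m

/-- A character as a product over all coordinates. [folklore] -/
theorem walsh_eq_prod_ite (S : Finset (Fin m)) (x : Fin m → Bool) :
    Literature.Probability.RandomGraphs.LowDegree.walsh S x = ∏ i, (if i ∈ S then Literature.Probability.RandomGraphs.LowDegree.sgn (x i) else 1) := by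
  rw [Literature.Probability.RandomGraphs.LowDegree.walsh, ← Finset.prod_filter]
  simp

/-- **Orthogonality of characters**: `∑_x χ_S(x) χ_T(x) = 2^m [S = T]` (O'Donnell 2014, §1.4). [cite: ODonnell2014, §1.4] -/
theorem sum_walsh_mul_walsh_index (S T : Finset (Fin m)) :
    ∑ x : Fin m → Bool, Literature.Probability.RandomGraphs.LowDegree.walsh S x * Literature.Probability.RandomGraphs.LowDegree.walsh T x = if S = T then (2 : ℝ) ^ m else 0 := by
  classical
  have key : ∀ x : Fin m → Bool, Literature.Probability.RandomGraphs.LowDegree.walsh S x * Literature.Probability.RandomGraphs.LowDegree.walsh T x =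
      ∏ i, ((if i ∈ S then Literature.Probability.RandomGraphs.LowDegree.sgn (x i) else 1) * (if i ∈ T then Literature.Probability.RandomGraphs.LowDegree.sgn (x i) else 1)) := by
    intro x
    rw [walsh_eq_prod_ite, walsh_eq_prod_ite, ← Finset.prod_mul_distrib]
  simp_rw [key]
  have h := Finset.prod_univ_sum (fun _ : Fin m => (Finset.univ : Finset Bool))
    (fun i b => (if i ∈ S then Literature.Probability.RandomGraphs.LowDegree.sgn b else (1 : ℝ)) * (if i ∈ T then Literature.Probability.RandomGraphs.LowDegree.sgn b else 1))
  rw [Fintype.piFinset_univ] at h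
  rw [← h]
  by_cases hST : S = T
  · subst hST
    rw [if_pos rfl]
    rw [Finset.prod_congr rfl (g := fun _ => (2 : ℝ)), Finset.prod_const, Finset.card_univ,
      Fintype.card_fin]
    intro i _
    by_cases hi : i ∈ S <;> simp [hi]
  · rw [if_neg hST]
    obtain ⟨i, hi⟩ : ∃ i, ¬ (i ∈ S ↔ i ∈ T) := by
      by_contra h
      push Not at h
      exact hST (Finset.ext h)
    apply Finset.prod_eq_zero (Finset.mem_univ i)
    by_cases hiS : i ∈ S
    · have hiT : i ∉ T := fun hiT => hi ⟨fun _ => hiT, fun _ => hiS⟩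
      simp [hiS, hiT, Literature.Probability.RandomGraphs.LowDegree.sgn]
    · have hiT : i ∈ T := by
        by_contra hiT; exact hi ⟨fun h => absurd h hiS, fun h => absurd h hiT⟩
      simp [hiS, hiT, Literature.Probability.RandomGraphs.LowDegree.sgn]

/-- **Fourier inversion** on the cube: `∑_S ĝ(S) χ_S(x) = g(x)` (O'Donnell 2014, Thm 1.1). [cite: ODonnell2014, Thm 1.1] -/
theorem sum_cubeFourierCoeff_mul_walsh (g : (Fin m → Bool) → ℝ) (x : Fin m → Bool) :
    ∑ S, cubeFourierCoeff g S * Literature.Probability.RandomGraphs.LowDegree.walsh S x = g x := by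
  unfold cubeFourierCoeff
  have h2 : (2 : ℝ) ^ m ≠ 0 := by positivity
  have e1 : ∀ S : Finset (Fin m), (∑ y, g y * Literature.Probability.RandomGraphs.LowDegree.walsh S y) / 2 ^ m * Literature.Probability.RandomGraphs.LowDegree.walsh S x =
      ∑ y, g y * (Literature.Probability.RandomGraphs.LowDegree.walsh S y * Literature.Probability.RandomGraphs.LowDegree.walsh S x) / 2 ^ m := by
    intro S
    rw [Finset.sum_div, Finset.sum_mul]
    refine Finset.sum_congr rfl fun y _ => ?_
    ring
  simp_rw [e1]
  rw [Finset.sum_comm]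
  have e2 : ∀ y : Fin m → Bool, ∑ S : Finset (Fin m), g y * (Literature.Probability.RandomGraphs.LowDegree.walsh S y * Literature.Probability.RandomGraphs.LowDegree.walsh S x) / 2 ^ m =
      g y * (∑ S : Finset (Fin m), Literature.Probability.RandomGraphs.LowDegree.walsh S y * Literature.Probability.RandomGraphs.LowDegree.walsh S x) / 2 ^ m := by
    intro y
    rw [Finset.mul_sum, Finset.sum_div]
  simp_rw [e2, Literature.Probability.RandomGraphs.LowDegree.sum_walsh_mul_walsh, Fintype.card_fin]
  simp_rw [mul_ite, mul_zero, ite_div, zero_div]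
  rw [Finset.sum_ite_eq' Finset.univ x]
  simp only [Finset.mem_univ, if_true]
  field_simp

/-- **Parseval**: `∑_S ĝ(S)² = 𝔼_x[g(x)²]` (O'Donnell 2014, §1.4). [cite: ODonnell2014, §1.4] -/
theorem sum_cubeFourierCoeff_sq (g : (Fin m → Bool) → ℝ) :
    ∑ S, cubeFourierCoeff g S ^ 2 = (∑ x, g x ^ 2) / 2 ^ m := by
  unfold cubeFourierCoeff
  have h2 : (2 : ℝ) ^ m ≠ 0 := by positivity
  calc ∑ S : Finset (Fin m), ((∑ x, g x * Literature.Probability.RandomGraphs.LowDegree.walsh S x) / 2 ^ m) ^ 2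
      = ∑ S : Finset (Fin m), (∑ x, ∑ y, g x * g y * (Literature.Probability.RandomGraphs.LowDegree.walsh S x * Literature.Probability.RandomGraphs.LowDegree.walsh S y)) / (2 ^ m) ^ 2 := by
        refine Finset.sum_congr rfl fun S _ => ?_
        rw [div_pow, sq, Finset.sum_mul_sum]
        congr 1
        refine Finset.sum_congr rfl fun x _ => Finset.sum_congr rfl fun y _ => ?_
        ring
    _ = (∑ x, ∑ y, g x * g y * ∑ S : Finset (Fin m), Literature.Probability.RandomGraphs.LowDegree.walsh S x * Literature.Probability.RandomGraphs.LowDegree.walsh S y) / (2 ^ m) ^ 2 := by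
        rw [← Finset.sum_div, Finset.sum_comm]
        congr 1
        refine Finset.sum_congr rfl fun x _ => ?_
        rw [Finset.sum_comm]
        refine Finset.sum_congr rfl fun y _ => ?_
        rw [Finset.mul_sum]
    _ = (∑ x, g x * g x * 2 ^ m) / (2 ^ m) ^ 2 := by
        congr 1
        refine Finset.sum_congr rfl fun x _ => ?_
        simp_rw [Literature.Probability.RandomGraphs.LowDegree.sum_walsh_mul_walsh, Fintype.card_fin]
        simp
    _ = (∑ x, g x ^ 2) / 2 ^ m := by
        rw [← Finset.sum_mul]
        field_simp

/-- `ĝ(∅) = 𝔼[g]`. [cite: ODonnell2014, §1.2] -/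
theorem cubeFourierCoeff_empty (g : (Fin m → Bool) → ℝ) :
    cubeFourierCoeff g ∅ = (∑ x, g x) / 2 ^ m := by
  simp [cubeFourierCoeff]

/-- Coefficients of a bounded function are bounded: `|g| ≤ 1 ⇒ |ĝ(S)| ≤ 1`. [cite: ODonnell2014, §1.2] -/
theorem abs_cubeFourierCoeff_le_one (g : (Fin m → Bool) → ℝ) (hg : ∀ x, |g x| ≤ 1)
    (S : Finset (Fin m)) : |cubeFourierCoeff g S| ≤ 1 := by
  unfold cubeFourierCoeff
  rw [abs_div, abs_of_pos (by positivity : (0 : ℝ) < 2 ^ m), div_le_one (by positivity)]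
  calc |∑ x, g x * Literature.Probability.RandomGraphs.LowDegree.walsh S x| ≤ ∑ x : Fin m → Bool, |g x * Literature.Probability.RandomGraphs.LowDegree.walsh S x| := Finset.abs_sum_le_sum_abs _ _
    _ ≤ ∑ _x : Fin m → Bool, (1 : ℝ) := by
        refine Finset.sum_le_sum fun x _ => ?_
        rw [abs_mul]
        have hw : |Literature.Probability.RandomGraphs.LowDegree.walsh S x| = 1 := by
          unfold Literature.Probability.RandomGraphs.LowDegree.walsh
          rw [Finset.abs_prod]
          exact Finset.prod_eq_one fun i _ => by cases x i <;> simp [Literature.Probability.RandomGraphs.LowDegree.sgn]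
        rw [hw, mul_one]
        exact hg x
    _ = 2 ^ m := by simp

/-! ### Restrictions -/

/-- A character at a point overridden on `J` by `σ` (`J.piecewise σ x`, the input side of the
restriction fixing `xᵢ = σᵢ` for `i ∈ J`, O'Donnell 2014, §3.3, `f_{J|z}`): the `J`-part is the
constant `∏_{i∈S∩J} χ(σᵢ)`, the rest is the character of `S ∖ J`. [cite: ODonnell2014, §3.3] -/
theorem walsh_piecewise (S J : Finset (Fin m)) (σ x : Fin m → Bool) :
    Literature.Probability.RandomGraphs.LowDegree.walsh S (J.piecewise σ x) =
      (∏ i ∈ S.filter (· ∈ J), Literature.Probability.RandomGraphs.LowDegree.sgn (σ i)) * Literature.Probability.RandomGraphs.LowDegree.walsh (S.filter (· ∉ J)) x := by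
  unfold Literature.Probability.RandomGraphs.LowDegree.walsh Finset.piecewise
  rw [← Finset.prod_ite]
  refine Finset.prod_congr rfl fun i _ => ?_
  split_ifs <;> rfl

/-- **Fourier coefficients of a restriction**: for `g_{J,σ}(x) = g(x|_{J ← σ})`,
`ĝ_{J,σ}(T) = ∑_{S : S∖J = T} ĝ(S) ∏_{i∈S∩J} χ(σᵢ)` (O'Donnell 2014, Prop. 3.21). [cite: ODonnell2014, Prop. 3.21] -/
theorem cubeFourierCoeff_piecewise (g : (Fin m → Bool) → ℝ) (J : Finset (Fin m))
    (σ : Fin m → Bool) (T : Finset (Fin m)) :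
    cubeFourierCoeff (fun x => g (J.piecewise σ x)) T =
      ∑ S, if S.filter (· ∉ J) = T then
        cubeFourierCoeff g S * ∏ i ∈ S.filter (· ∈ J), Literature.Probability.RandomGraphs.LowDegree.sgn (σ i) else 0 := by
  have hinv : ∀ x, g (J.piecewise σ x) =
      ∑ S, cubeFourierCoeff g S * Literature.Probability.RandomGraphs.LowDegree.walsh S (J.piecewise σ x) :=
    fun x => (sum_cubeFourierCoeff_mul_walsh g _).symm
  rw [cubeFourierCoeff]
  simp_rw [hinv, walsh_piecewise, Finset.sum_mul]
  rw [Finset.sum_comm, Finset.sum_div]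
  refine Finset.sum_congr rfl fun S _ => ?_
  have e : ∀ x : Fin m → Bool, cubeFourierCoeff g S *
      ((∏ i ∈ S.filter (· ∈ J), Literature.Probability.RandomGraphs.LowDegree.sgn (σ i)) * Literature.Probability.RandomGraphs.LowDegree.walsh (S.filter (· ∉ J)) x) * Literature.Probability.RandomGraphs.LowDegree.walsh T x =
      cubeFourierCoeff g S * (∏ i ∈ S.filter (· ∈ J), Literature.Probability.RandomGraphs.LowDegree.sgn (σ i)) *
        (Literature.Probability.RandomGraphs.LowDegree.walsh (S.filter (· ∉ J)) x * Literature.Probability.RandomGraphs.LowDegree.walsh T x) := fun x => by ring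
  simp_rw [e]
  rw [← Finset.mul_sum, sum_walsh_mul_walsh_index]
  have h2 : (2 : ℝ) ^ m ≠ 0 := by positivity
  split_ifs
  · field_simp
  · simp

/-- A restricted function does not depend on the overridden coordinates, so its coefficients
vanish off `J^c`: `ĝ_{J,σ}(T) = 0` unless `T ∩ J = ∅`. [cite: ODonnell2014, Prop. 3.21] -/
theorem cubeFourierCoeff_piecewise_eq_zero (g : (Fin m → Bool) → ℝ) (J : Finset (Fin m))
    (σ : Fin m → Bool) {T : Finset (Fin m)} (hT : ∃ i ∈ T, i ∈ J) :
    cubeFourierCoeff (fun x => g (J.piecewise σ x)) T = 0 := by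
  rw [cubeFourierCoeff_piecewise]
  refine Finset.sum_eq_zero fun S _ => ?_
  rw [if_neg]
  rintro rfl
  obtain ⟨i, hi, hiJ⟩ := hT
  exact (Finset.mem_filter.1 hi).2 hiJ

end Literature.Computability.Complexity.LowDegree

end
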